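import Mathlib
import Literature.MathematicalPhysics.QuantumFieldTheory.Balaban1983to89.B9Eq323Ker

/-! # `Balaban1983to89.B9Eq319Onto` — B9 (3.18)–(3.19): the block-averaging operator Q′ (with parallel transports) is
ONTO, hence Q′\* is injective — the last lattice input of "obvious" in Theorem 3.11, kernel-checked

CITATION HEADER.  Paper sub-cell `b2b-balaban-b09` (gen 6, journal claim SHARPEN T06.1 (3.19) Q′ onto ∕ Q′\* injective
pass 11 ∕ C-B9-32-ONTO, cell pub-balaban; v1.1 = gen-7 DOCFIX G-pv03-12: docstring only, every declaration byte-identical to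
v1 p181263) on T. Balaban, *Propagators for lattice gauge theories in a background field*,
Commun. Math. Phys. 99 (1985) 389–434 [`Balaban1985BackgroundPropagators`] (= B9), pp. 393, 416 [PDF 5, 28], with
[5] = T. Bałaban, *Averaging operations for lattice gauge theories*, Commun. Math. Phys. 98 (1985) 17–51
[`Balaban1985Averaging`] (= B7), pp. 17–18, and [3] = *Propagators and renormalization transformations … I*, Commun.
Math. Phys. 95 (1984) 17–40 [`Balaban1984PropagatorsI`] (= B5), p. 25 (renders `b2b-balaban-ref1/pages/
1985-cmp99-background-propagators/…-p005-x2.png`, `…-p028-x2.png`, `…/1984-cmp95-propagators-rt-I/…-p009-x2.png`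
read as images this session; B7 pp. 17–18 read in the held text `paper:balaban1985-cmp98-averaging` p0001–p0002).

WHAT IS PRINTED (verbatim).
* B9 p. 393, (3.18)–(3.19): *"where Q′λ is defined on 𝔅 = ⋃_{j=0}^{k} Λ_j by the formulas (Q′λ)(y) = (Q′_j(U)λ)(y) for
  y ∈ Λ_j, (Q′(V)λ)(y) = Σ_{x∈B(y)} L^{−d}R(V(Γ_{y,x}))λ(x), (Q′_j(U)λ)(y) = (Q′(Ū^{j−1})·…·Q′(Ū)Q′(U)λ)(y) =
  Σ_{x∈B^j(y)} L^{−jd}R(U(Γ^{(j)}_{y,x}))λ(x), y ∈ T^{(j)}_{L^jη}. (3.19) The contours Γ^{(j)}_{y,x}, x ∈ B^j(y), and the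
  contour variables U(Γ^{(j)}_{y,x}) were defined by (52), (53) in [5]."*; p. 393: *"Λ_j = Ω_j^{(j)} \ Ω_{j+1}^{(j)}, … or
  Ω_j \ Ω_{j+1} = B^j(Λ_j)"*.
* B7 p. 17, (2): *"For a point y ∈ L^nηZ^d (or any lattice δZ^d), we define a block of an order j as the cube B^j(y) =
  {x ∈ L^{−j}L^nηZ^d : y_μ ≦ x_μ < y_μ + L^nη, μ = 1, …, d} (2) (or the corresponding cube with L^nη replaced by δ)."*
  — used here with L^nη replaced by δ = L^jη per the printed parenthesis, so that x ∈ ηZ^d, y ∈ B^j(y), and distinct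
  blocks of one order are disjoint (v1.1: quotation corrected per GAPS G-pv03-12 — v1 had L^j for the printed L^n and
  elided the x-lattice inside the quotation marks; the specialisation now stands outside them);
  p. 18, (9): *"For an oriented contour Γ = ⋃_{i=0}^{n−1} ⟨x_i, x_{i+1}⟩ we define U(Γ) = Π_{i=0}^{n−1} U(x_i, x_{i+1}),
  where the order of factors in the product is the same as the order of bonds in Γ."*; B9 p. 390: *"R(U)X = UXU^{−1}"*.
* B5 p. 25: *"… ⟨ω, Q′_kG′_k²Q′\*_kω⟩ = ‖G′_kQ′\*_kω‖² = 0, then Q′\*_kω = 0, hence ω = 0."*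
* B9 p. 416, Theorem 3.11: *"the operators Δ′_a, G′, (Q′G′²Q′\*)^{−1}, Δ_a, G are positive definite. This is obvious for
  the first three operators"*.

WHY THIS FILE.  Pass 9 (`B9Thm311Data`, C-B9-30) reduced "obvious" to five inputs; pass 10 (`B9Eq323Ker`, C-B9-31)
proved the kernel condition; the remaining lattice input is `hqs` — Q′\* INJECTIVE ("Q′\*ω = 0, hence ω = 0"), i.e. Q′
ONTO.  This file proves it for the (3.19) operator `B9Eq323Ker.avgQ` (block sums with parallel transports along the
contours): a function λ supported at the block centres, λ(y) = w(y,y)^{−1}ω(y), has Q′λ = ω, because y ∈ B(y) with the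
trivial contour Γ_{y,y}, and the centre of another block does not lie in B(y).  An abstract lemma then turns "Q′ onto"
into "Q′\* injective" for any adjoint pair in real inner-product spaces (the typing of pass 9).

TYPING (as `B9Eq323Ker`).  Sites `X`, fibre `V`, transports `τ`, `pathTr`, centres `Y` with `y : Y → X` (the centre as
a site), blocks `B : Y → Finset X`, contours `Γ : Y → X → List X` (sites after the centre), weights `w : Y → X → ℝ`
(L^{−jd} in print), `avgQ τ w B Γ λ y c` = (Q′λ)(c).  HYPOTHESES named where used, each a printed structural fact:
`hy : y c ∈ B c` (B7 (2): y_μ ≤ y_μ < y_μ + L^jη), `hΓ : Γ c (y c) = []` (the contour from y to y is trivial; B7 uses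
Γ_{y,x} only for x ≠ y, (58)/(60)), `hw : w c (y c) ≠ 0` (L^{−jd} ≠ 0), `hdisj : c ≠ c' → y c' ∉ B c` (blocks of 𝔅 are
pairwise disjoint: Λ_j ⊂ L^jη-lattice and B^j(Λ_j) = Ω_j \ Ω_{j+1} are disjoint across j).

WHAT THIS FILE CERTIFIES (kernel, zero sorry; [folklore]; value = the input `hqs` of Theorem 3.11's "obvious" clause
at the typing of passes 9–10, NOT summit progress).
1. `centreFun` — the centre-supported preimage; `centreFun_centre`, `centreFun_off_centre`.
2. `avgQ_centreFun` — (3.19) applied to it returns ω: Q′(centreFun ω) = ω; `avgQ_surjective` — **Q′ IS ONTO**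
   (as a map (X → V) → (Y → V)); `y_injective_of_disjoint` (centres of distinct blocks are distinct sites).
3. `injective_of_adjoint_of_surjective` — for linear q : E → F, qs : F → E between real inner-product spaces with
   ⟨q x, φ⟩ = ⟨x, qs φ⟩: q onto ⇒ qs injective (B5 p. 25's "Q′\*ω = 0, hence ω = 0"; dimension-free), and
   `surjective_of_adjoint_of_injective` (finite dimension: qs injective ⇒ q onto), so `hqs` of `B9Thm311Data` ⟺ Q′ onto.
NOT HERE: the realisation of L²(Ω₀, 𝔤), L²(𝔅) as Mathlib inner-product spaces carrying `avgQ` as the `q` of pass 9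
(the common typing gap of passes 5–11: pi types `X → V` with weighted products have no `InnerProductSpace` instance;
recorded, not bridged), the concrete blocks/contours of B7 (any system with the four named properties), bounds.
Cell records: GAPS C-B9-32, DIVERGENCE D-b09.23. -/

namespace Literature.MathematicalPhysics.QuantumFieldTheory.Balaban1983to89.B9Eq319Onto

open B9Eq323Ker
open scoped BigOperators

/-! ## §1  The centre-supported preimage and Q′ onto -/

section Onto

variable {X : Type*} {V : Type*} {Y : Type*} [AddCommGroup V] [Module ℝ V]

/-- Centres of distinct blocks are distinct sites (from y ∈ B(y) and disjointness). [cite: Balaban1985Averaging, (2) p.17] -/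
theorem y_injective_of_disjoint (B : Y → Finset X) (y : Y → X) (hy : ∀ c, y c ∈ B c)
    (hdisj : ∀ c c', c ≠ c' → y c' ∉ B c) : Function.Injective y := by
  intro c c' h
  by_contra hne
  exact hdisj c c' hne (h ▸ hy c)

open Classical in
/-- The centre-supported function λ with λ(y) = w(y,y)^{−1}·ω(y) at every centre y and λ = 0 off the centres.
[folklore] -/
noncomputable def centreFun (w : Y → X → ℝ) (y : Y → X) (ω : Y → V) (x : X) : V :=
  if h : ∃ c, y c = x then (w h.choose (y h.choose))⁻¹ • ω h.choose else 0

/-- Value at a centre. [folklore] -/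
theorem centreFun_centre (w : Y → X → ℝ) (y : Y → X) (hinj : Function.Injective y) (ω : Y → V) (c : Y) :
    centreFun w y ω (y c) = (w c (y c))⁻¹ • ω c := by
  classical
  unfold centreFun
  have h : ∃ c', y c' = y c := ⟨c, rfl⟩
  rw [dif_pos h]
  have hc : h.choose = c := hinj h.choose_spec
  rw [hc]

/-- Value off the centres. [folklore] -/
theorem centreFun_off_centre (w : Y → X → ℝ) (y : Y → X) (ω : Y → V) (x : X) (hx : ∀ c, y c ≠ x) :
    centreFun w y ω x = 0 := by
  classical
  unfold centreFun
  rw [dif_neg (not_exists.mpr hx)]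

/-- **(3.19) on the centre-supported function returns ω**: (Q′λ)(y) = w(y,y)·R(U(Γ_{y,y}))λ(y) + Σ_{x≠y} (…)·0 = ω(y).
[cite: Balaban1985BackgroundPropagators, (3.19) p.393] -/
theorem avgQ_centreFun (τ : X → X → V →ₗ[ℝ] V) (w : Y → X → ℝ) (B : Y → Finset X) (Γ : Y → X → List X)
    (y : Y → X) (hy : ∀ c, y c ∈ B c) (hΓ : ∀ c, Γ c (y c) = []) (hw : ∀ c, w c (y c) ≠ 0)
    (hdisj : ∀ c c', c ≠ c' → y c' ∉ B c) (ω : Y → V) (c : Y) :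
    avgQ τ w B Γ (centreFun w y ω) y c = ω c := by
  have hinj := y_injective_of_disjoint B y hy hdisj
  rw [avgQ, Finset.sum_eq_single (y c)]
  · rw [hΓ c, pathTr_singleton, LinearMap.id_apply, centreFun_centre w y hinj ω c, smul_smul,
      mul_inv_cancel₀ (hw c), one_smul]
  · intro x hx hne
    have hoff : ∀ c', y c' ≠ x := by
      intro c' h
      by_cases hcc : c = c'
      · subst hcc; exact hne h.symm
      · exact hdisj c c' hcc (h ▸ hx)
    rw [centreFun_off_centre w y ω x hoff, map_zero, smul_zero]
  · intro h
    exact absurd (hy c) h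

/-- **Q′ IS ONTO**: every ω on the centres is the block average (3.19) of some λ on the sites.
[cite: Balaban1985BackgroundPropagators, (3.19) p.393; Balaban1984PropagatorsI, p.25] -/
theorem avgQ_surjective (τ : X → X → V →ₗ[ℝ] V) (w : Y → X → ℝ) (B : Y → Finset X) (Γ : Y → X → List X)
    (y : Y → X) (hy : ∀ c, y c ∈ B c) (hΓ : ∀ c, Γ c (y c) = []) (hw : ∀ c, w c (y c) ≠ 0)
    (hdisj : ∀ c c', c ≠ c' → y c' ∉ B c) :
    Function.Surjective (fun l : X → V => fun c : Y => avgQ τ w B Γ l y c) :=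
  fun ω => ⟨centreFun w y ω, funext fun c => avgQ_centreFun τ w B Γ y hy hΓ hw hdisj ω c⟩

/-- `avgQ` is linear in λ (a linear map (X → V) →ₗ (Y → V)). [folklore] -/
def avgQLin (τ : X → X → V →ₗ[ℝ] V) (w : Y → X → ℝ) (B : Y → Finset X) (Γ : Y → X → List X) (y : Y → X) :
    (X → V) →ₗ[ℝ] (Y → V) where
  toFun l c := avgQ τ w B Γ l y c
  map_add' l l' := by
    funext c
    simp only [avgQ, Pi.add_apply, map_add, smul_add, Finset.sum_add_distrib]
  map_smul' r l := by
    funext c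
    simp only [avgQ, Pi.smul_apply, map_smul, RingHom.id_apply, Finset.smul_sum, smul_comm r]

/-- Unfolding of `avgQLin`. [folklore] -/
theorem avgQLin_apply (τ : X → X → V →ₗ[ℝ] V) (w : Y → X → ℝ) (B : Y → Finset X) (Γ : Y → X → List X)
    (y : Y → X) (l : X → V) (c : Y) : avgQLin τ w B Γ y l c = avgQ τ w B Γ l y c := rfl

/-- The linear Q′ is onto. [cite: Balaban1985BackgroundPropagators, (3.19) p.393] -/
theorem avgQLin_surjective (τ : X → X → V →ₗ[ℝ] V) (w : Y → X → ℝ) (B : Y → Finset X) (Γ : Y → X → List X)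
    (y : Y → X) (hy : ∀ c, y c ∈ B c) (hΓ : ∀ c, Γ c (y c) = []) (hw : ∀ c, w c (y c) ≠ 0)
    (hdisj : ∀ c c', c ≠ c' → y c' ∉ B c) : Function.Surjective (avgQLin τ w B Γ y) :=
  avgQ_surjective τ w B Γ y hy hΓ hw hdisj

end Onto

/-! ## §2  Onto ⟹ adjoint injective (B5 p. 25 "Q′\*ω = 0, hence ω = 0") -/

section Adjoint

variable {E F : Type*} [NormedAddCommGroup E] [InnerProductSpace ℝ E] [NormedAddCommGroup F]
  [InnerProductSpace ℝ F]

/-- For an adjoint pair ⟨Qx, φ⟩ = ⟨x, Q\*φ⟩: Q onto ⇒ Q\* injective (dimension-free).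
[cite: Balaban1984PropagatorsI, p.25] -/
theorem injective_of_adjoint_of_surjective (q : E →ₗ[ℝ] F) (qs : F →ₗ[ℝ] E)
    (hadj : ∀ (x : E) (φ : F), inner ℝ (q x) φ = inner ℝ x (qs φ)) (hq : Function.Surjective q) :
    Function.Injective qs := by
  intro φ ψ h
  rw [← sub_eq_zero, ← inner_self_eq_zero (𝕜 := ℝ)]
  obtain ⟨x, hx⟩ := hq (φ - ψ)
  have h1 : inner ℝ (q x) (φ - ψ) = inner ℝ x (qs (φ - ψ)) := hadj x (φ - ψ)
  rw [map_sub, h, sub_self, inner_zero_right, hx] at h1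
  exact h1

/-- Conversely, in finite dimension: Q\* injective ⇒ Q onto (so pass 9's `hqs` is exactly "Q′ onto"). [folklore] -/
theorem surjective_of_adjoint_of_injective [FiniteDimensional ℝ E] [FiniteDimensional ℝ F] (q : E →ₗ[ℝ] F)
    (qs : F →ₗ[ℝ] E) (hadj : ∀ (x : E) (φ : F), inner ℝ (q x) φ = inner ℝ x (qs φ))
    (hqs : Function.Injective qs) : Function.Surjective q := by
  intro φ
  by_contra hφ
  push Not at hφ
  -- φ ∉ range q; take the component of φ orthogonal to range q: it is killed by qs, contradiction
  set K : Submodule ℝ F := LinearMap.range q with hK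
  have hφK : φ ∉ K := by
    intro h
    obtain ⟨x, hx⟩ := LinearMap.mem_range.mp h
    exact hφ x hx
  set ψ : F := φ - K.starProjection φ with hψ
  have hψorth : ψ ∈ Kᗮ := by
    rw [hψ]
    exact K.sub_starProjection_mem_orthogonal φ
  have hψne : ψ ≠ 0 := by
    intro h0
    apply hφK
    rw [hψ, sub_eq_zero] at h0
    rw [h0]
    exact K.starProjection_apply_mem φ
  have hqsψ : qs ψ = 0 := by
    rw [← inner_self_eq_zero (𝕜 := ℝ), ← hadj]
    have hmem : q (qs ψ) ∈ K := LinearMap.mem_range_self q (qs ψ)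
    exact (Submodule.mem_orthogonal K ψ).mp hψorth (q (qs ψ)) hmem
  exact hψne (hqs (by rw [hqsψ, map_zero]))

end Adjoint

end Literature.MathematicalPhysics.QuantumFieldTheory.Balaban1983to89.B9Eq319Onto
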